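import Summits.CriticalPhenomena.PercolationContinuityZ3.Theorems.PercNearOneGluingNoHeavyQuantLightPairCatHullColumns
import HarnessLib

/-!
# QUANT lane R8, T-DEC: THE LIGHT GLUED PAIR IS IN THE GATED CATERPILLAR HULL ON AN EXPLICIT REGION — closed-form five-column
# certificates for `T = (R¹[q](R^c[s]))²` at its natural light floor `y = q·s` (census-2 g76, part 2 of 2: weights, identity, membership)

builds on p205010 (kernel theorem, internal audit signed; external expert review pending)

Support file (`--supports stmt-CriticalPhenomena-4575`), QUANT lane census seat prim-quant-census-2 (gen 76), rung R8 of
`run/shared/lean/prim/quant/LADDER.md`.  Closed-form real definitions (gates, weights) and theorems; standard axioms, no sorries.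

WHAT.  With the column kit of part 1 (`…QuantLightPairCatHullColumns`): for EVERY blob size `c ≥ 1` and all real `(q, s)` in the explicit region
  `R_Lt(c) = { 1/2 < q < 1, 0 < s < 1, 2(1−q) ≤ c·qs, qs < 2q − 1, 2q(1+cs) − 1 − qs ≤ c, W_E ≥ 0, W_B ≥ 0, W_Z ≥ 0 }`
(the last three are the closed-form weights below, rational in `q, s, c`), the glued pair `T = (R¹[q](R^c[s]))²` is an EXACT five-column member of
the gated caterpillar hull at its natural floor `y = qs` and its own mean `m = 2q(1+cs)`:
  `T = (1−q)·gate_q(A) + W_E·E(g_E) + W_B·B(β, y/β) + W_Z·Z(a₁, y/a₁) + W_X·Lt(σ, y/σ)`,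
  `β = 2q−1`, `g_E = 2qs − 2(1−q)/c`, `a₁ = (β + c·y)/(c+1)`, `σ = (m − 1 − y)/c`,
  `W_X = 2q(1−q)s / x_c` with `x_c = σ − y = (β + qs(c−1))/c`, `W_E = q − W_X − βs`, `W_B = (qβ(1−s)² − (1−g_E)·W_E)/(β − y)`, `W_Z = βs − W_B`.
(`lpT_inGatedCatHull_Lt`; the identity `lpT_eq_mixLt` holds for all parameters off the poles.)  The region contains, e.g., for `c = 3`:
`q = .9, s ∈ [.196, .488]`; `q = .95, s ∈ [.112, .442]`; `q = .99, s ∈ [.026, .408]` (exact scan, step 1/1000; census-2 g76 memo LIGHTPAIR-G76.md),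
and similar bands for every `c` tested (2 … 20); each rational instance's hypotheses are decided by `norm_num`.  COROLLARIES: membership at
every floor `x ≤ qs` (`_below`), `SDEC (qs) (2c+2) T`, and **`treeBuiltCatHullLight_lpT_Lt`: the light node `TreeBuiltCatHullBelow (1/2)` restricted
to these laws holds for every tree-built presentation** (these ARE light-node instances: natural floor `qs < 1/2` whenever `qs < 2q − 1 ≤ … `, and
the node's binder reaches them at every floor `≤ qs`).  A second closed form (column `C = δ_{c+1} ∗ Bern(m−c−1)` instead of `Lt`) covering the
census diagonal `s = 1/2`, `q ≥ (2c+2)/(2c+3)` hypothesis-free is the sequel `…QuantLightPairCatHullDiag`.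
WHY IT MATTERS.  First INFINITE family of genuinely light, interacting (`k = 2`) instances of `CatPairLight` / `TreeBuiltCatHullLight` settled by name
(so far: finitely many census certificates + the `x = 1/2` boundary family `…QuantHalfPairCatHull`); the structure — peel `(1−q)·gate_q(ρ∗ρ)`
(FREEHULL-G75 §4c), then serve the sure-relay residual by two FLOOR-TIGHT merged caterpillars (`2c`-blob; sure `(c+1)`-block: the relay merging of
§4b), one blob forest and one atom-`c` column — is the candidate template for the general light pair.
HONEST STATUS.  Instances on an explicit region only; outside it (e.g. `s ≥ .55` for `q ≤ .9`, or `q ≤ .6`) this dictionary fails while the census still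
finds (other) certificates; `TreeBuiltCatHullLight`, `CatPairLight`, `SiblingStep`, `FarTreeRow` remain OPEN; RATE class log\* / honest sentence of
`run/shared/lean/prim/quant/README.md` unchanged.  [this work]; census: prim-quant-census-2 g75/g76.  Nothing here is cited as a published result.
The gluing rows served [cite: KozmaNitzan2024, Conjecture 3 (p. 15)]; product measure [cite: Grimmett1999, §1.3 p. 10].
-/

noncomputable section

open scoped BigOperators

namespace Summit.CriticalPhenomena.PercolationContinuityZ3.Theorems
namespace Quant
namespace LawDec

open Finset

/-! ### Closed-form gates and weights -/

/-- `E`'s blob gate `g_E = 2qs − 2(1−q)/c` (so that `2 + c·g_E = 2q(1+cs)`). [this work] -/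
def lpGE (c : ℕ) (q s : ℝ) : ℝ := 2 * q * s - 2 * (1 - q) / c

/-- `Z`'s spine gate `a₁ = (2q − 1 + c·qs)/(c+1)`. [this work] -/
def lpA1 (c : ℕ) (q s : ℝ) : ℝ := (2 * q - 1 + c * (q * s)) / (c + 1)

/-- `Lt`'s spine gate `σ = (2q(1+cs) − 1 − qs)/c`. [this work] -/
def lpSig (c : ℕ) (q s : ℝ) : ℝ := (2 * q * (1 + c * s) - 1 - q * s) / c

/-- `Lt`'s atom-`(c+1)` mass `x_c = σ − y = (2q − 1 + qs(c−1))/c`. [this work] -/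
def lpXcLt (c : ℕ) (q s : ℝ) : ℝ := (2 * q - 1 + q * s * (c - 1)) / c

/-- weight of the atom-`c` column: `W_X = 2q(1−q)s / x_c`. [this work] -/
def lpWX (q s xc : ℝ) : ℝ := 2 * q * (1 - q) * s / xc

/-- weight of `E`: `W_E = q − W_X − (2q−1)s`. [this work] -/
def lpWE (q s xc : ℝ) : ℝ := q - lpWX q s xc - (2 * q - 1) * s

/-- weight of `B`: `W_B = (q(2q−1)(1−s)² − (1 − g_E)·W_E)/(2q − 1 − qs)`. [this work] -/
def lpWB (c : ℕ) (q s xc : ℝ) : ℝ := (q * (2 * q - 1) * (1 - s) ^ 2 - (1 - lpGE c q s) * lpWE q s xc) / (2 * q - 1 - q * s)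

/-- weight of `Z`: `W_Z = (2q−1)s − W_B`. [this work] -/
def lpWZ (c : ℕ) (q s xc : ℝ) : ℝ := (2 * q - 1) * s - lpWB c q s xc

/-- the five-column mixture with the `Lt` atom-`c` column. [this work] -/
def lpMixLt (c : ℕ) (q s : ℝ) : ℕ → ℝ := fun h =>
  (1 - q) * gate (lpColA c s) q h + lpWE q s (lpXcLt c q s) * lpColE c (lpGE c q s) h +
    lpWB c q s (lpXcLt c q s) * lpColB c (2 * q - 1) (q * s / (2 * q - 1)) h +
    lpWZ c q s (lpXcLt c q s) * lpColZ c (lpA1 c q s) (q * s / lpA1 c q s) h +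
    lpWX q s (lpXcLt c q s) * lpColLt c (lpSig c q s) (q * s / lpSig c q s) h

/-- value form of the `Lt` mixture (coefficients collected per atom; pure bookkeeping). [this work] -/
theorem lpMixLt_apply (c : ℕ) (q s : ℝ) (h : ℕ) :
    lpMixLt c q s h =
      (1 - q) * (1 - q) * pointLaw 0 h +
      (lpWB c q s (lpXcLt c q s) * (1 - (2 * q - 1)) + lpWZ c q s (lpXcLt c q s) * (1 - lpA1 c q s) +
          lpWX q s (lpXcLt c q s) * (1 - lpSig c q s)) * pointLaw 1 h +
      ((1 - q) * q * (1 - s) ^ 2 + lpWE q s (lpXcLt c q s) * (1 - lpGE c q s) +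
          lpWB c q s (lpXcLt c q s) * ((2 * q - 1) * (1 - q * s / (2 * q - 1)))) * pointLaw 2 h +
      (lpWX q s (lpXcLt c q s) * (lpSig c q s * (1 - q * s / lpSig c q s))) * pointLaw (c + 1) h +
      ((1 - q) * q * (2 * s * (1 - s)) + lpWE q s (lpXcLt c q s) * lpGE c q s +
          lpWZ c q s (lpXcLt c q s) * (lpA1 c q s * (1 - q * s / lpA1 c q s)) +
          lpWX q s (lpXcLt c q s) * (lpSig c q s * (q * s / lpSig c q s))) * pointLaw (c + 2) h +
      ((1 - q) * q * s ^ 2 + lpWB c q s (lpXcLt c q s) * ((2 * q - 1) * (q * s / (2 * q - 1))) +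
          lpWZ c q s (lpXcLt c q s) * (lpA1 c q s * (q * s / lpA1 c q s))) * pointLaw (2 * c + 2) h := by
  simp only [lpMixLt, gate, lpColA_apply, lpColE_apply, lpColB_apply, lpColZ_apply, lpColLt_apply]
  rw [gate_ite_eq_pointLaw]
  ring

/-- coefficient check at atom `1`. [this work] -/
theorem lpMixLt_coeff1 (c : ℕ) (q s : ℝ) (hc0 : (c : ℝ) ≠ 0) (hD1 : 2 * q - 1 - q * s ≠ 0) (hD2 : 2 * q - 1 + q * s * (c - 1) ≠ 0) :
    lpWB c q s (lpXcLt c q s) * (1 - (2 * q - 1)) + lpWZ c q s (lpXcLt c q s) * (1 - lpA1 c q s) +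
        lpWX q s (lpXcLt c q s) * (1 - lpSig c q s) = 2 * q * (1 - q) * (1 - s) := by
  have hc1 : (c : ℝ) + 1 ≠ 0 := by positivity
  simp only [lpWZ, lpWB, lpWE, lpWX, lpXcLt, lpGE, lpA1, lpSig]
  generalize eD1 : 2 * q - 1 - q * s = D1 at hD1 ⊢
  generalize eD2 : 2 * q - 1 + q * s * ((c : ℝ) - 1) = D2 at hD2 ⊢
  field_simp
  subst eD1 eD2
  ring

/-- coefficient check at atom `2`. [this work] -/
theorem lpMixLt_coeff2 (c : ℕ) (q s : ℝ) (hc0 : (c : ℝ) ≠ 0) (hb : 2 * q - 1 ≠ 0) (hD1 : 2 * q - 1 - q * s ≠ 0)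
    (hD2 : 2 * q - 1 + q * s * (c - 1) ≠ 0) :
    (1 - q) * q * (1 - s) ^ 2 + lpWE q s (lpXcLt c q s) * (1 - lpGE c q s) +
        lpWB c q s (lpXcLt c q s) * ((2 * q - 1) * (1 - q * s / (2 * q - 1))) = q ^ 2 * (1 - s) ^ 2 := by
  simp only [lpWB, lpWE, lpWX, lpXcLt, lpGE]
  generalize eD1 : 2 * q - 1 - q * s = D1 at hD1 ⊢
  generalize eD2 : 2 * q - 1 + q * s * ((c : ℝ) - 1) = D2 at hD2 ⊢
  generalize eB : 2 * q - 1 = B at hb eD1 eD2 ⊢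
  field_simp
  subst eB eD1 eD2
  ring

/-- coefficient check at atom `c + 1`. [this work] -/
theorem lpMixLt_coeffc1 (c : ℕ) (q s : ℝ) (hc0 : (c : ℝ) ≠ 0) (hD2 : 2 * q - 1 + q * s * (c - 1) ≠ 0)
    (hD4 : 2 * q * (1 + c * s) - 1 - q * s ≠ 0) :
    lpWX q s (lpXcLt c q s) * (lpSig c q s * (1 - q * s / lpSig c q s)) = 2 * q * (1 - q) * s := by
  simp only [lpWX, lpXcLt, lpSig]
  generalize eD2 : 2 * q - 1 + q * s * ((c : ℝ) - 1) = D2 at hD2 ⊢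
  generalize eD4 : 2 * q * (1 + (c : ℝ) * s) - 1 - q * s = D4 at hD4 ⊢
  field_simp
  subst eD2 eD4
  ring

/-- coefficient check at atom `c + 2`. [this work] -/
theorem lpMixLt_coeffc2 (c : ℕ) (q s : ℝ) (hc0 : (c : ℝ) ≠ 0) (hD1 : 2 * q - 1 - q * s ≠ 0) (hD2 : 2 * q - 1 + q * s * (c - 1) ≠ 0)
    (hD3 : 2 * q - 1 + c * (q * s) ≠ 0) (hD4 : 2 * q * (1 + c * s) - 1 - q * s ≠ 0) :
    (1 - q) * q * (2 * s * (1 - s)) + lpWE q s (lpXcLt c q s) * lpGE c q s +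
        lpWZ c q s (lpXcLt c q s) * (lpA1 c q s * (1 - q * s / lpA1 c q s)) +
        lpWX q s (lpXcLt c q s) * (lpSig c q s * (q * s / lpSig c q s)) = 2 * q ^ 2 * s * (1 - s) := by
  have hc1 : (c : ℝ) + 1 ≠ 0 := by positivity
  simp only [lpWZ, lpWB, lpWE, lpWX, lpXcLt, lpGE, lpA1, lpSig]
  generalize eD1 : 2 * q - 1 - q * s = D1 at hD1 ⊢
  generalize eD2 : 2 * q - 1 + q * s * ((c : ℝ) - 1) = D2 at hD2 ⊢
  generalize eD3 : 2 * q - 1 + (c : ℝ) * (q * s) = D3 at hD3 ⊢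
  generalize eD4 : 2 * q * (1 + (c : ℝ) * s) - 1 - q * s = D4 at hD4 ⊢
  field_simp
  subst eD1 eD2 eD3 eD4
  ring

/-- coefficient check at atom `2c + 2`. [this work] -/
theorem lpMixLt_coefftop (c : ℕ) (q s : ℝ) (hb : 2 * q - 1 ≠ 0) (hD3 : 2 * q - 1 + c * (q * s) ≠ 0) :
    (1 - q) * q * s ^ 2 + lpWB c q s (lpXcLt c q s) * ((2 * q - 1) * (q * s / (2 * q - 1))) +
        lpWZ c q s (lpXcLt c q s) * (lpA1 c q s * (q * s / lpA1 c q s)) = q ^ 2 * s ^ 2 := by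
  have hc1 : (c : ℝ) + 1 ≠ 0 := by positivity
  have hA : lpA1 c q s ≠ 0 := by
    simp only [lpA1]; exact div_ne_zero hD3 hc1
  have e1 : (2 * q - 1) * (q * s / (2 * q - 1)) = q * s := by field_simp
  have e2 : lpA1 c q s * (q * s / lpA1 c q s) = q * s := by field_simp
  rw [e1, e2, lpWZ]
  ring

/-- **THE CLOSED-FORM CERTIFICATE IDENTITY (variant `Lt`)**, pointwise, for all parameters off the poles. [this work] -/
theorem lpT_eq_mixLt (c : ℕ) (q s : ℝ) (hc0 : (c : ℝ) ≠ 0) (hb : 2 * q - 1 ≠ 0) (hD1 : 2 * q - 1 - q * s ≠ 0)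
    (hD2 : 2 * q - 1 + q * s * (c - 1) ≠ 0) (hD3 : 2 * q - 1 + c * (q * s) ≠ 0) (hD4 : 2 * q * (1 + c * s) - 1 - q * s ≠ 0) (h : ℕ) :
    lpT c q s h = lpMixLt c q s h := by
  rw [lpT_apply, lpMixLt_apply]
  linear_combination (-(pointLaw 1 h)) * lpMixLt_coeff1 c q s hc0 hD1 hD2 + (-(pointLaw 2 h)) * lpMixLt_coeff2 c q s hc0 hb hD1 hD2 +
    (-(pointLaw (c + 1) h)) * lpMixLt_coeffc1 c q s hc0 hD2 hD4 + (-(pointLaw (c + 2) h)) * lpMixLt_coeffc2 c q s hc0 hD1 hD2 hD3 hD4 +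
    (-(pointLaw (2 * c + 2) h)) * lpMixLt_coefftop c q s hb hD3

/-! ### Membership on the explicit region (variant `Lt`) -/

/-- the certificate data: weights. [this work] -/
def lpW (c : ℕ) (q s : ℝ) : Fin 5 → ℝ :=
  ![1 - q, lpWE q s (lpXcLt c q s), lpWB c q s (lpXcLt c q s), lpWZ c q s (lpXcLt c q s), lpWX q s (lpXcLt c q s)]

/-- the certificate data: outer gates. [this work] -/
def lpS (q : ℝ) : Fin 5 → ℝ := ![q, 1, 1, 1, 1]

/-- the certificate data: column tops. [this work] -/
def lpN (c : ℕ) : Fin 5 → ℕ := ![2 * c + 2, c + 2, 2 * c + 2, 2 * c + 2, c + 2]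

/-- the certificate data: column laws. [this work] -/
def lpP (c : ℕ) (q s : ℝ) : Fin 5 → ℕ → ℝ :=
  ![lpColA c s, lpColE c (lpGE c q s), lpColB c (2 * q - 1) (q * s / (2 * q - 1)), lpColZ c (lpA1 c q s) (q * s / lpA1 c q s),
    lpColLt c (lpSig c q s) (q * s / lpSig c q s)]

/-- **THE LIGHT GLUED PAIR IS IN THE GATED CATERPILLAR HULL AT ITS NATURAL FLOOR** on the explicit region `R_Lt(c)`:
`InGatedCatHull (qs) (2q(1+cs)) (2c+2) T` for `T = (R¹[q](R^c[s]))²`, every `c ≥ 1`. The hypotheses are the validity of the five closed-form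
columns (`hE`, `hB`, `hσ`) and the nonnegativity of the three closed-form weights; each is decided by `norm_num` on rational data. [this work] -/
theorem lpT_inGatedCatHull_Lt (c : ℕ) (q s : ℝ) (hc : 1 ≤ c) (hq : 1 / 2 < q) (hq1 : q < 1) (hs0 : 0 < s) (hs1 : s < 1)
    (hy : q * s < 1 / 2) (hE : 2 * (1 - q) ≤ c * (q * s)) (hB : q * s < 2 * q - 1) (hσ : 2 * q * (1 + c * s) - 1 - q * s ≤ c)
    (hWE : 0 ≤ lpWE q s (lpXcLt c q s)) (hWB : 0 ≤ lpWB c q s (lpXcLt c q s)) (hWZ : 0 ≤ lpWZ c q s (lpXcLt c q s)) :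
    InGatedCatHull (q * s) (2 * q * (1 + c * s)) (2 * c + 2) (lpT c q s) := by
  have hcR : (1 : ℝ) ≤ c := by exact_mod_cast hc
  have hc0 : (c : ℝ) ≠ 0 := by positivity
  have hq0 : 0 < q := by linarith
  have hy0 : 0 < q * s := mul_pos hq0 hs0
  have hy1 : q * s < 1 := by linarith
  have hb0 : 0 < 2 * q - 1 := by linarith
  have hD1 : 0 < 2 * q - 1 - q * s := by linarith
  have hD2 : 0 < 2 * q - 1 + q * s * (c - 1) := by nlinarith
  have hD3 : 0 < 2 * q - 1 + c * (q * s) := by nlinarith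
  have hD4 : 0 < 2 * q * (1 + c * s) - 1 - q * s := by nlinarith
  have hXc : 0 < lpXcLt c q s := by unfold lpXcLt; positivity
  have hWX : 0 ≤ lpWX q s (lpXcLt c q s) := by
    unfold lpWX; exact div_nonneg (by nlinarith) hXc.le
  -- gates in range
  have hgE0 : q * s ≤ lpGE c q s := by
    have : 2 * (1 - q) / (c : ℝ) ≤ q * s := by rw [div_le_iff₀ (by positivity)]; nlinarith
    unfold lpGE; linarith
  have hgE1 : lpGE c q s ≤ 1 := by
    unfold lpGE; have : 0 ≤ 2 * (1 - q) / (c : ℝ) := by positivity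
    linarith
  have hA1y : q * s < lpA1 c q s := by
    unfold lpA1; rw [lt_div_iff₀ (by positivity)]; nlinarith
  have hA11 : lpA1 c q s ≤ 1 := by
    unfold lpA1; rw [div_le_one (by positivity)]; nlinarith
  have hSy : q * s < lpSig c q s := by
    unfold lpSig; rw [lt_div_iff₀ (by positivity)]; nlinarith
  have hS1 : lpSig c q s ≤ 1 := by
    unfold lpSig; rw [div_le_one (by positivity)]; linarith
  refine ⟨Fin 5, inferInstance, lpW c q s, lpS q, lpN c, lpP c q s, ?_, ?_, ?_, ?_, ?_, ?_, fun h => ?_⟩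
  · intro i
    fin_cases i
    · show 0 ≤ 1 - q; linarith
    · exact hWE
    · exact hWB
    · exact hWZ
    · exact hWX
  · rw [Fin.sum_univ_five]
    show (1 - q) + lpWE q s (lpXcLt c q s) + lpWB c q s (lpXcLt c q s) + lpWZ c q s (lpXcLt c q s) + lpWX q s (lpXcLt c q s) = 1
    simp only [lpWE, lpWZ]; ring
  · intro i
    fin_cases i
    · show q * s < q ∧ q ≤ 1; exact ⟨by nlinarith, hq1.le⟩
    all_goals exact ⟨hy1, le_rfl⟩
  · intro i
    fin_cases i
    · show CatBuilt (q * s / q) (2 * c + 2) (lpColA c s)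
      rw [mul_div_cancel_left₀ s hq0.ne']; exact cat_lpColA c s hs0 hs1
    · show CatBuilt (q * s / 1) (c + 2) (lpColE c (lpGE c q s))
      rw [div_one]; exact cat_lpColE c (q * s) _ hy0 hy1 hgE0 hgE1
    · show CatBuilt (q * s / 1) (2 * c + 2) (lpColB c (2 * q - 1) (q * s / (2 * q - 1)))
      rw [div_one]; exact cat_lpColB c (q * s) _ hy0 hB (by linarith)
    · show CatBuilt (q * s / 1) (2 * c + 2) (lpColZ c (lpA1 c q s) (q * s / lpA1 c q s))
      rw [div_one]; exact cat_lpColZ c (q * s) _ hy0 hA1y hA11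
    · show CatBuilt (q * s / 1) (c + 2) (lpColLt c (lpSig c q s) (q * s / lpSig c q s))
      rw [div_one]; exact cat_lpColLt c (q * s) _ hy0 hSy hS1
  · intro i
    fin_cases i
    · show 2 * c + 2 ≤ 2 * c + 2; exact le_rfl
    · show c + 2 ≤ 2 * c + 2; omega
    · show 2 * c + 2 ≤ 2 * c + 2; exact le_rfl
    · show 2 * c + 2 ≤ 2 * c + 2; exact le_rfl
    · show c + 2 ≤ 2 * c + 2; omega
  · intro i
    fin_cases i
    · exact lpColA_mean c q s
    · show (1 : ℝ) * ∑ h ∈ Finset.range (c + 2 + 1), (h : ℝ) * lpColE c (lpGE c q s) h = 2 * q * (1 + c * s)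
      rw [lpColE_mean]; unfold lpGE; field_simp; ring
    · show (1 : ℝ) * ∑ h ∈ Finset.range (2 * c + 2 + 1), (h : ℝ) * lpColB c (2 * q - 1) (q * s / (2 * q - 1)) h = 2 * q * (1 + c * s)
      rw [lpColB_mean, mul_div_cancel₀ _ hb0.ne']; ring
    · show (1 : ℝ) * ∑ h ∈ Finset.range (2 * c + 2 + 1), (h : ℝ) * lpColZ c (lpA1 c q s) (q * s / lpA1 c q s) h = 2 * q * (1 + c * s)
      rw [lpColZ_mean, mul_div_cancel₀ _ (hy0.trans hA1y).ne']
      unfold lpA1; field_simp; ring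
    · show (1 : ℝ) * ∑ h ∈ Finset.range (c + 2 + 1), (h : ℝ) * lpColLt c (lpSig c q s) (q * s / lpSig c q s) h = 2 * q * (1 + c * s)
      rw [lpColLt_mean, mul_div_cancel₀ _ (hy0.trans hSy).ne']
      unfold lpSig; field_simp; ring
  · rw [Fin.sum_univ_five, lpT_eq_mixLt c q s hc0 hb0.ne' hD1.ne' hD2.ne' hD3.ne' hD4.ne' h]
    show lpMixLt c q s h = (1 - q) * gate (lpColA c s) q h + lpWE q s (lpXcLt c q s) * gate (lpColE c (lpGE c q s)) 1 h +
      lpWB c q s (lpXcLt c q s) * gate (lpColB c (2 * q - 1) (q * s / (2 * q - 1))) 1 h +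
      lpWZ c q s (lpXcLt c q s) * gate (lpColZ c (lpA1 c q s) (q * s / lpA1 c q s)) 1 h +
      lpWX q s (lpXcLt c q s) * gate (lpColLt c (lpSig c q s) (q * s / lpSig c q s)) 1 h
    simp only [lpMixLt, gate_one]

/-- **… hence at every floor `0 < x ≤ qs`**, with the mean written as the law's own first moment. [this work] -/
theorem lpT_inGatedCatHull_Lt_below (c : ℕ) (q s : ℝ) (hc : 1 ≤ c) (hq : 1 / 2 < q) (hq1 : q < 1) (hs0 : 0 < s) (hs1 : s < 1)
    (hy : q * s < 1 / 2) (hE : 2 * (1 - q) ≤ c * (q * s)) (hB : q * s < 2 * q - 1) (hσ : 2 * q * (1 + c * s) - 1 - q * s ≤ c)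
    (hWE : 0 ≤ lpWE q s (lpXcLt c q s)) (hWB : 0 ≤ lpWB c q s (lpXcLt c q s)) (hWZ : 0 ≤ lpWZ c q s (lpXcLt c q s))
    (x : ℝ) (hx0 : 0 < x) (hx : x ≤ q * s) :
    InGatedCatHull x (∑ h ∈ Finset.range (2 * c + 2 + 1), (h : ℝ) * lpT c q s h) (2 * c + 2) (lpT c q s) := by
  rw [lpT_mean]
  exact (lpT_inGatedCatHull_Lt c q s hc hq hq1 hs0 hs1 hy hE hB hσ hWE hWB hWZ).mono hx0 hx

/-- **the light glued pair is SDEC at its natural floor** on the region (no oracle, no induction hypothesis). [this work] -/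
theorem sdec_lpT_Lt (c : ℕ) (q s : ℝ) (hc : 1 ≤ c) (hq : 1 / 2 < q) (hq1 : q < 1) (hs0 : 0 < s) (hs1 : s < 1)
    (hy : q * s < 1 / 2) (hE : 2 * (1 - q) ≤ c * (q * s)) (hB : q * s < 2 * q - 1) (hσ : 2 * q * (1 + c * s) - 1 - q * s ≤ c)
    (hWE : 0 ≤ lpWE q s (lpXcLt c q s)) (hWB : 0 ≤ lpWB c q s (lpXcLt c q s)) (hWZ : 0 ≤ lpWZ c q s (lpXcLt c q s)) :
    SDEC (q * s) (2 * c + 2) (lpT c q s) :=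
  sdec_of_inGatedCatHull (mul_pos (by linarith) hs0) (lpT_inGatedCatHull_Lt c q s hc hq hq1 hs0 hs1 hy hE hB hσ hWE hWB hWZ)

/-- **THE LIGHT NODE ON THESE LAWS**: every tree-built presentation `TreeBuilt x M T` at a floor `x ≤ qs` is in the hull at `x`, its own mean and
its own top (any presentation has `M ≥ 2c + 2`). [this work] -/
theorem treeBuiltCatHull_lpT_Lt (c : ℕ) (q s : ℝ) (hc : 1 ≤ c) (hq : 1 / 2 < q) (hq1 : q < 1) (hs0 : 0 < s) (hs1 : s < 1)
    (hy : q * s < 1 / 2) (hE : 2 * (1 - q) ≤ c * (q * s)) (hB : q * s < 2 * q - 1) (hσ : 2 * q * (1 + c * s) - 1 - q * s ≤ c)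
    (hWE : 0 ≤ lpWE q s (lpXcLt c q s)) (hWB : 0 ≤ lpWB c q s (lpXcLt c q s)) (hWZ : 0 ≤ lpWZ c q s (lpXcLt c q s))
    (x : ℝ) (M : ℕ) (hT : TreeBuilt x M (lpT c q s)) (hx : x ≤ q * s) :
    InGatedCatHull x (∑ h ∈ Finset.range (M + 1), (h : ℝ) * lpT c q s h) M (lpT c q s) := by
  obtain ⟨hx0, _, _, hzero, _, _⟩ := treeBuilt_lawFacts hT
  have hq0 : 0 < q := by linarith
  have hM : 2 * c + 2 ≤ M := by
    by_contra hlt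
    have h0 := hzero (2 * c + 2) (by omega)
    rw [lpT_apply] at h0
    have e : pointLaw (2 * c + 2) (2 * c + 2) = 1 := by simp [pointLaw_apply]
    have e0 : pointLaw 0 (2 * c + 2) = 0 := by simp [pointLaw_apply]
    have e1 : pointLaw 1 (2 * c + 2) = 0 := by simp [pointLaw_apply]
    have e2 : pointLaw 2 (2 * c + 2) = 0 := by rw [pointLaw_apply, if_neg (by omega)]
    have e3 : pointLaw (c + 1) (2 * c + 2) = 0 := by rw [pointLaw_apply, if_neg (by omega)]
    have e4 : pointLaw (c + 2) (2 * c + 2) = 0 := by rw [pointLaw_apply, if_neg (by omega)]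
    rw [e, e0, e1, e2, e3, e4] at h0
    have : 0 < q ^ 2 * s ^ 2 := by positivity
    linarith
  obtain ⟨a, rfl⟩ := Nat.exists_eq_add_of_le hM
  rw [sum_range_extend (fun h => (h : ℝ) * lpT c q s h) (2 * c + 2) a (fun h hh => by rw [lpT_eq_zero c q s h hh, mul_zero]),
    lpT_mean]
  exact ((lpT_inGatedCatHull_Lt c q s hc hq hq1 hs0 hs1 hy hE hB hσ hWE hWB hWZ).mono hx0 hx).mono_top hM

end LawDec
end Quant
end Summit.CriticalPhenomena.PercolationContinuityZ3.Theorems
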